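import Summits.KontsevichZagierPeriods.KontsevichZagierPeriods.Theorems.FurushoPentagonSectorToKernelNashCellStraighten
import Summits.KontsevichZagierPeriods.KontsevichZagierPeriods.Theorems.FurushoPentagonSectorToKernelNashCad
import Summits.KontsevichZagierPeriods.KontsevichZagierPeriods.Theorems.FurushoPentagonSectorToKernelNashCellAssembly

/-!
# `SectorToKernel` (stmt-KontsevichZagierPeriods-10813), line `effective-cube-surjection`:
# stub F `stub_nashCellReductionOf` — bounded volumes reduce to open-cube Nash classes, given A–D

The lead's stub of skeleton v6: from the four ingredient statements A (generic analyticity of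
`ℚ`-semialgebraic functions), B (affine straightening of an open band is a move), C (refinement of the
base of a cylindrical decomposition), D (cell facts), every bounded `ℚ`-semialgebraic volume `[K, 1]` is
congruent modulo the Kontsevich–Zagier relations to a `ℤ`-combination of open-cube classes
`[(0,1)ᵐ, J]` with `J` real analytic on the open cube (Bochnak–Coste–Roy Prop. 2.9.10 at the level of
MOVES, rules (1a) and (2) only).  Composition of the three landed helper files: the straightening step
(`straighten_step_of`, which consumes B), the Nash cylindrical decomposition with straightenable open
bounded cells (`nash_cad_of`, which consumes A, C, D) and the assembly (`nashCellReduction_of_nashCad`).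
With A–D landed (`stub_saAnalyticOffSmall`, `stub_affineOpenBand`, `stub_cadRefine`, `stub_cadCellFacts`)
this is the first registered stub `stub_nashCellReduction` of item stmt-KontsevichZagierPeriods-17978
(`HermiteRigidity.CubeResolution`, line `nash-rectilinearisation`) as a theorem.
[Bochnak–Coste–Roy 1998, Prop. 2.9.10; Kontsevich–Zagier 2001, §1.2]
-/

noncomputable section

namespace Summit.KontsevichZagierPeriods.FurushoPentagon.SectorToKernel

open Set MeasureTheory
open Literature.ModelTheory.ExponentialFields
open Literature.NumberTheory.Transcendental
open Literature.NumberTheory.Transcendental.KZ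

/-- **F — bounded volumes reduce to open-cube Nash classes, given A–D** (registered stub of skeleton v6,
line `effective-cube-surjection`; = `stub_nashCellReduction` of item 17978 made conditional on the four
ingredients).  Proof: `nashCellReduction_of_nashCad` ∘ `nash_cad_of` ∘ `straighten_step_of`.
[cite: BochnakCosteRoy1998, Prop. 2.9.10] [cite: KontsevichZagier2001, §1.2 rules (1),(2)] -/
theorem stub_nashCellReductionOf :
    (∀ {m : ℕ} {s : Set (Fin m → ℝ)} {f : (Fin m → ℝ) → ℝ},
      IsOpen s → IsSemialgebraicFunOn ℚ s f →
      ∃ Z : Set (Fin m → ℝ), Z ⊆ s ∧ IsSemialgebraic ℚ Z ∧ interior Z = ∅ ∧ IsOpen (s \ Z) ∧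
        AnalyticOnNhd ℝ f (s \ Z)) →
    (∀ {M : ℕ} {G : Set (Fin M → ℝ)}, IsOpen G → IsSemialgebraic ℚ G →
      ∀ {α β : (Fin M → ℝ) → ℝ}, IsSemialgebraicFunOn ℚ G α → IsSemialgebraicFunOn ℚ G β →
      DifferentiableOn ℝ α G → DifferentiableOn ℝ β G → (∀ y ∈ G, 0 < β y) →
      ∀ r' : IntegralRep (M + 1),
        r'.domain = {z | (Fin.init z : Fin M → ℝ) ∈ G ∧ α (Fin.init z) < z (Fin.last M) ∧
          z (Fin.last M) < α (Fin.init z) + β (Fin.init z)} →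
        ∃ r : IntegralRep (M + 1),
          r.domain = {z | (Fin.init z : Fin M → ℝ) ∈ G ∧ 0 < z (Fin.last M) ∧ z (Fin.last M) < 1} ∧
          (r.integrand = fun z => r'.integrand (Fin.snoc (Fin.init z)
            (α (Fin.init z) + β (Fin.init z) * z (Fin.last M))) * β (Fin.init z)) ∧
          of r - of r' ∈ relations) →
    (∀ {n : ℕ} (𝒮 𝒮' : Finset (Set (Fin n → ℝ))) (𝒯 : Finset (Set (Fin (n + 1) → ℝ)))
      (l : Set (Fin n → ℝ) → ℕ) (ξ : (S : Set (Fin n → ℝ)) → Fin (l S) → (Fin n → ℝ) → ℝ),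
      Setoid.IsPartition (𝒯 : Set (Set (Fin (n + 1) → ℝ))) → (∀ T ∈ 𝒯, IsSemialgebraic ℚ T) →
      IsCylindricalDecomposition ℚ n 𝒮 →
      (∀ S ∈ 𝒮, ∀ j, ContinuousOn (ξ S j) S) → (∀ S ∈ 𝒮, ∀ j, IsSemialgebraicFunOn ℚ S (ξ S j)) →
      (∀ S ∈ 𝒮, ∀ x ∈ S, StrictMono fun j => ξ S j x) →
      (∀ T, T ∈ 𝒯 ↔ ∃ S ∈ 𝒮, (∃ j, T = graphOver S (ξ S j)) ∨ ∃ j, T = bandOver S (ξ S) j) →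
      IsCylindricalDecomposition ℚ n 𝒮' → (∀ S ∈ 𝒮, ∃ 𝒞 ⊆ 𝒮', ⋃₀ (𝒞 : Set (Set (Fin n → ℝ))) = S) →
      ∃ (𝒯' : Finset (Set (Fin (n + 1) → ℝ))) (l' : Set (Fin n → ℝ) → ℕ)
        (ξ' : (S : Set (Fin n → ℝ)) → Fin (l' S) → (Fin n → ℝ) → ℝ),
        Setoid.IsPartition (𝒯' : Set (Set (Fin (n + 1) → ℝ))) ∧ (∀ T ∈ 𝒯', IsSemialgebraic ℚ T) ∧
        (∀ S ∈ 𝒮', ∀ j, ContinuousOn (ξ' S j) S) ∧ (∀ S ∈ 𝒮', ∀ j, IsSemialgebraicFunOn ℚ S (ξ' S j)) ∧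
        (∀ S ∈ 𝒮', ∀ x ∈ S, StrictMono fun j => ξ' S j x) ∧
        (∀ T, T ∈ 𝒯' ↔ ∃ S ∈ 𝒮', (∃ j, T = graphOver S (ξ' S j)) ∨ ∃ j, T = bandOver S (ξ' S) j) ∧
        (∀ T ∈ 𝒯, ∃ 𝒞 ⊆ 𝒯', ⋃₀ (𝒞 : Set (Set (Fin (n + 1) → ℝ))) = T) ∧
        (∀ S' ∈ 𝒮', ∃ S ∈ 𝒮, S' ⊆ S ∧ ∃ h : l' S' = l S,
          ∀ j, ∀ x ∈ S', ξ' S' j x = ξ S (Fin.cast h j) x)) →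
    ((∀ (n : ℕ) (𝒮 : Finset (Set (Fin n → ℝ))), IsCylindricalDecomposition ℚ n 𝒮 →
        ∀ S ∈ 𝒮, IsOpen S ∨ interior S = ∅) ∧
      (∀ (n l : ℕ) (S : Set (Fin n → ℝ)) (ξ : Fin l → (Fin n → ℝ) → ℝ) (j : Fin (l + 1)),
        S.Nonempty → (∀ x ∈ S, StrictMono fun i => ξ i x) → Bornology.IsBounded (bandOver S ξ j) →
        j ≠ 0 ∧ j ≠ Fin.last l ∧ Bornology.IsBounded S) ∧
      (∀ (n : ℕ) (S : Set (Fin n → ℝ)) (a b : (Fin n → ℝ) → ℝ), IsOpen S → ContinuousOn a S →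
        ContinuousOn b S → IsOpen {z : Fin (n + 1) → ℝ | Fin.init z ∈ S ∧ a (Fin.init z) < z (Fin.last n) ∧
          z (Fin.last n) < b (Fin.init z)})) →
    ∀ (m : ℕ) (K : IntegralRep m), Bornology.IsBounded K.domain → (∀ x ∈ K.domain, K.integrand x = 1) →
      ∃ c ∈ AddSubgroup.closure {d : FormalRep | ∃ v : IntegralRep m,
        v.domain = {x : Fin m → ℝ | ∀ i, 0 < x i ∧ x i < 1} ∧
        AnalyticOnNhd ℝ v.integrand {x : Fin m → ℝ | ∀ i, 0 < x i ∧ x i < 1} ∧ d = of v},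
        of K - c ∈ relations :=
  fun hA hB hC hD => nashCellReduction_of_nashCad hD.1
    (nash_cad_of hA hC hD.1 hD.2.1 (fun hS'o hS's _ _ hlo_a hhi_a hlo_s hhi_s hlt IH r hdom han =>
      straighten_step_of hS'o hS's hlo_a hhi_a hlo_s hhi_s hlt hB IH r hdom han))


end Summit.KontsevichZagierPeriods.FurushoPentagon.SectorToKernel
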